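import Mathlib.FieldTheory.Perfect
import Literature.NumberTheory.Automorphic.BrandtModuleResidueCentral
import HarnessLib

/-!
# Residual classification III: the residue ring of an order is never commutative and reduced

Ninth layer of the proof files for the named fact `brandtMatrix_comm` of `BrandtModule.lean`
(Vignéras, LNM 800, III §5 ex. 5.8; Eichler 1973, II §6 Thm. 2). The last central sub-case of
the residual classification: a non-trivial idempotent `e` of `A = O / p O` with `eAf = fAe = 0`,
`|eAe| = |fAf| = p²` and *no* non-zero square-zero element in `eAe`. Then `A` is commutative and
reduced — and this is impossible for **any** `ℤ`-order `O` in a quaternion algebra over `ℚ`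
(maximality is not needed):

* `IsZOrder.mul_comm_of_mem_peirceCorner_sq` — a corner of order `p²` is commutative (it is
  spanned by its unit and any other element); `IsZOrder.residue_comm_reduced_of_central` — hence
  `A = eAe × fAf` is commutative and reduced (reducedness through `barA : fAf → eAe`).
* **The derivation argument** `IsZOrder.commute_of_residue_comm_reduced`: if `A` is commutative
  and reduced then `O` is commutative. Induction on `k`: if `[O, O] ⊆ p^k O` then for fixed `x`
  the map `y ↦ [x, y] / p^k` is an integral derivation; modulo `p` it kills `p`-th powers
  (`p b^{p-1} D b`), and every element of the finite reduced commutative `𝔽_p`-algebra `A` is a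
  `p`-th power (Frobenius is injective, Mathlib `frobenius_inj`, hence bijective), so
  `[O, O] ⊆ p^{k+1} O`; finally `⋂_k p^k O = 0` (coordinates in a `ℤ`-basis).
* `IsZOrder.false_of_commute` — a quaternion algebra is not commutative (`Algebra.IsCentral`
  with `dim = 4`), so **the reduced-commutative residue ring cannot occur**
  (`IsZOrder.false_of_central_reduced`).
* Assembly of the idempotent branch: **a maximal order with a non-trivial idempotent in
  `O₁ / p O₁` is residually split at `p`** (`IsMaximalZOrder.isResiduallySplit_of_idempotent`),
  combining the size constraint with `BrandtModuleResidueSplit` / `BrandtModuleResidueCentral`.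

## References

* M.-F. Vignéras, *Arithmétique des algèbres de quaternions*, LNM 800 (1980), Ch. I §1
  (a quaternion algebra is central simple of dimension 4), Ch. II §§1–2 [VignerasLNM800].
-/

noncomputable section

open scoped Pointwise

universe u

namespace Literature.NumberTheory.Automorphic

namespace IsZOrder

variable {B : Type u} [Ring B] [Algebra ℚ B] [IsQuaternionAlgebra ℚ B] {O : Submodule ℤ B} {p : ℕ}

/-! ### Corners of order `p²` are commutative -/

/-- **A Peirce corner `eAe` of order `p²` is commutative**: if `a ∉ ℤ e` then `e, a` span the
corner, so every `b` is `k e + l a` and commutes with `a`. [folklore] -/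
theorem mul_comm_of_mem_peirceCorner_sq (hO : IsZOrder O) (hp : p.Prime) {e : hO.Residue p}
    (he : IsIdempotentElem e) (hee : Nat.card (peirceCorner e e) = p ^ 2)
    {a b : hO.Residue p} (ha : a ∈ peirceCorner e e) (hb : b ∈ peirceCorner e e) : a * b = b * a := by
  have hea : e * a = a := mul_left_eq_self_of_mem_peirceCorner he ha
  have hae : a * e = a := mul_right_eq_self_of_mem_peirceCorner he ha
  have heb : e * b = b := mul_left_eq_self_of_mem_peirceCorner he hb
  have hbe : b * e = b := mul_right_eq_self_of_mem_peirceCorner he hb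
  by_cases hline : ∃ k : ℤ, a = (k : hO.Residue p) * e
  · obtain ⟨k, rfl⟩ := hline
    rw [mul_assoc, heb, ← mul_assoc, ← (Int.cast_commute k b).eq, mul_assoc, hbe]
  · -- `e, a` are independent, hence span the corner
    have hind : ∀ k l : ℤ, (k : hO.Residue p) * e + (l : hO.Residue p) * a = 0 →
        (p : ℤ) ∣ k ∧ (p : ℤ) ∣ l := by
      intro k l hkl
      have hl : (p : ℤ) ∣ l := by
        by_contra hnd
        obtain ⟨m, hm⟩ := hO.exists_intCast_mul_eq_one hp hnd
        apply hline
        have h2 : ((m * k : ℤ) : hO.Residue p) * e + a = 0 := by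
          have := congrArg ((m : hO.Residue p) * ·) hkl
          simpa only [mul_add, mul_zero, ← mul_assoc, hm, one_mul, ← Int.cast_mul] using this
        refine ⟨-(m * k), ?_⟩
        rw [Int.cast_neg, neg_mul]
        exact eq_neg_of_add_eq_zero_right h2
      have he0 : e ≠ 0 := fun h0 => hline ⟨0, by rw [← hea, h0, zero_mul, Int.cast_zero, zero_mul]⟩
      rw [(hO.intCast_residue_eq_zero_iff hp).mpr hl, zero_mul, add_zero] at hkl
      exact ⟨hO.dvd_of_intCast_mul_eq_zero hp he0 hkl, hl⟩
    obtain ⟨k, l, rfl⟩ := hO.exists_pair_of_mem_peirceCorner hp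
      (by rw [mem_peirceCorner, he.eq, he.eq]) ha hind hee b hb
    rw [mul_add, add_mul, ← mul_assoc, ← (Int.cast_commute k a).eq, mul_assoc, hae, mul_assoc, hea,
      ← mul_assoc a, ← (Int.cast_commute l a).eq, mul_assoc]

/-! ### The central reduced case: `A` is commutative and reduced -/

/-- **In the central case with a square-zero-free corner, `A = O / p O` is commutative and
reduced.** (`A = eAe × fAf` with both factors of order `p²`, hence commutative; a square-zero
element has square-zero components, and `barA` carries `fAf` onto `eAe`.) [folklore] -/
theorem residue_comm_reduced_of_central (hO : IsZOrder O) (hp : p.Prime) {e : hO.Residue p}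
    (he : IsIdempotentElem e) (hbar : hO.barA p e = 1 - e)
    (hef : Nat.card (peirceCorner e (1 - e)) = 1) (hfe : Nat.card (peirceCorner (1 - e) e) = 1)
    (hee : Nat.card (peirceCorner e e) = p ^ 2)
    (hnosq : ∀ ε ∈ peirceCorner e e, ε * ε = 0 → ε = 0) :
    (∀ a b : hO.Residue p, a * b = b * a) ∧ ∀ a : hO.Residue p, a * a = 0 → a = 0 := by
  have hf := he.one_sub
  have hcen := hO.central_of_corners_trivial he hef hfe
  have hff : Nat.card (peirceCorner (1 - e) (1 - e)) = p ^ 2 := by rw [← hO.card_peirceCorner_eq hbar, hee]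
  -- decomposition `a = e a e + f a f`
  have hdec : ∀ a : hO.Residue p, a = e * a * e + (1 - e) * a * (1 - e) := fun a => by
    have h1 : e * a = e * a * e := (hcen a).1
    have h2 : a * e = e * a * e := (hcen a).2
    have hx : (1 - e) * a * (1 - e) = a - e * a - a * e + e * a * e := by noncomm_ring
    rw [hx]
    generalize ht : e * a * e = t at h1 h2 ⊢
    rw [h1, h2]
    abel
  have hcross : ∀ a b : hO.Residue p, (e * a * e) * ((1 - e) * b * (1 - e)) = 0 := fun a b =>
    mul_eq_zero_of_mem_peirceCorner (mul_mul_mem_peirceCorner he he a)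
      (mul_mul_mem_peirceCorner hf hf b) he.mul_one_sub_self
  have hcross' : ∀ a b : hO.Residue p, ((1 - e) * a * (1 - e)) * (e * b * e) = 0 := fun a b =>
    mul_eq_zero_of_mem_peirceCorner (mul_mul_mem_peirceCorner hf hf a)
      (mul_mul_mem_peirceCorner he he b) he.one_sub_mul_self
  have hmul : ∀ a b : hO.Residue p,
      a * b = (e * a * e) * (e * b * e) + ((1 - e) * a * (1 - e)) * ((1 - e) * b * (1 - e)) := fun a b => by
    conv_lhs => rw [hdec a, hdec b]
    rw [add_mul, mul_add, mul_add, hcross, hcross', add_zero, zero_add]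
  refine ⟨fun a b => ?_, fun a haa => ?_⟩
  · rw [hmul a b, hmul b a,
      hO.mul_comm_of_mem_peirceCorner_sq hp he hee (mul_mul_mem_peirceCorner he he a)
        (mul_mul_mem_peirceCorner he he b),
      hO.mul_comm_of_mem_peirceCorner_sq hp hf hff (mul_mul_mem_peirceCorner hf hf a)
        (mul_mul_mem_peirceCorner hf hf b)]
  · -- components of `a² = 0`
    set a₁ := e * a * e with ha₁
    set a₂ := (1 - e) * a * (1 - e) with ha₂
    have hm₁ : a₁ ∈ peirceCorner e e := mul_mul_mem_peirceCorner he he a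
    have hm₂ : a₂ ∈ peirceCorner (1 - e) (1 - e) := mul_mul_mem_peirceCorner hf hf a
    have hsum : a₁ * a₁ + a₂ * a₂ = 0 := (hmul a a).symm.trans haa
    have hea₂ : e * a₂ = 0 := mul_left_eq_zero_of_mem_peirceCorner hm₂ he.mul_one_sub_self
    have ha1 : a₁ * a₁ = 0 := by
      have h := congrArg (fun y => e * y * e) hsum
      simp only [mul_add, add_mul, mul_zero, zero_mul] at h
      rwa [← mul_assoc e a₂, hea₂, zero_mul, zero_mul, add_zero, ← mul_assoc e a₁,
        mul_left_eq_self_of_mem_peirceCorner he hm₁, mul_assoc,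
        mul_right_eq_self_of_mem_peirceCorner he hm₁] at h
    have ha1' : a₁ = 0 := hnosq _ hm₁ ha1
    have ha2 : a₂ * a₂ = 0 := by rwa [ha1', zero_mul, zero_add] at hsum
    -- transport to `eAe` by `barA`
    have hb : hO.barA p a₂ ∈ peirceCorner e e := by
      have := hO.barA_mem_peirceCorner hm₂
      rwa [hO.barA_one_sub hbar] at this
    have hb0 : hO.barA p a₂ = 0 := hnosq _ hb (by rw [← barA_mul, ha2, barA_zero])
    have ha2' : a₂ = 0 := hO.barA_injective (by rw [hb0, barA_zero])
    rw [hdec a, ← ha₁, ← ha₂, ha1', ha2', add_zero]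

/-! ### The derivation argument: a commutative reduced residue ring forces `O` commutative -/

omit [Algebra ℚ B] [IsQuaternionAlgebra ℚ B] in
/-- Powers of elements of an order lie in the order. [folklore] -/
theorem pow_mem (hO : IsZOrder O) {b : B} (hb : b ∈ O) (n : ℕ) : b ^ n ∈ O := by
  induction n with
  | zero => rw [pow_zero]; exact hO.one_mem
  | succ m ih => rw [pow_succ]; exact hO.mul_mem _ ih _ hb

/-- **One step of the derivation argument.** If `A = O / p O` is commutative and reduced and
`[O, O] ⊆ p^k O` (`k ≥ 1`), then `[O, O] ⊆ p^{k+1} O`: for fixed `x`, `c(y) = [x, y] / p^k` is an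
integral derivation; `c(b^p) ≡ p b^{p-1} c(b) ≡ 0`, and every class mod `p` is a `p`-th power
(Frobenius on the finite reduced commutative `A` is bijective). [folklore] -/
theorem commutator_mem_smul_succ [IsAddTorsionFree B] (hO : IsZOrder O) (hp : p.Prime)
    (hcomm : ∀ a b : hO.Residue p, a * b = b * a) (hred : ∀ a : hO.Residue p, a * a = 0 → a = 0)
    {k : ℕ} (hk : ∀ x ∈ O, ∀ y ∈ O, x * y - y * x ∈ ((p : ℤ) ^ k) • O) :
    ∀ x ∈ O, ∀ y ∈ O, x * y - y * x ∈ ((p : ℤ) ^ (k + 1)) • O := by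
  classical
  haveI : Fact p.Prime := ⟨hp⟩
  have hpk : ((p : ℤ) ^ k) ≠ 0 := pow_ne_zero k (by exact_mod_cast hp.ne_zero)
  -- the commutative reduced `𝔽_p`-algebra structure on `A`
  letI : CommRing (hO.Residue p) := { (inferInstance : Ring (hO.Residue p)) with mul_comm := hcomm }
  haveI : IsReduced (hO.Residue p) := (isReduced_iff_pow_one_lt 2 one_lt_two).mpr fun a ha =>
    hred a (by rw [← pow_two]; exact ha)
  haveI : CharP (hO.Residue p) p := ⟨fun n => by
    have := hO.intCast_residue_eq_zero_iff hp (k := (n : ℤ))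
    rw [Int.cast_natCast] at this
    exact this.trans Int.natCast_dvd_natCast⟩
  haveI : ExpChar (hO.Residue p) p := ExpChar.prime hp
  haveI : Finite (hO.Residue p) := hO.finite_residue hp.ne_zero
  have hsurj : Function.Surjective (frobenius (hO.Residue p) p) :=
    Finite.surjective_of_injective (frobenius_inj (hO.Residue p) p)
  intro x hx
  -- the integral derivation `c`
  have hc : ∀ y ∈ O, ∃ c ∈ O, x * y - y * x = ((p : ℤ) ^ k) • c := fun y hy =>
    (Submodule.mem_smul_pointwise_iff_exists _ _ O).mp (hk x hx y hy) |>.imp fun c hc => ⟨hc.1, hc.2.symm⟩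
  choose! c hcO hc using hc
  have hcancel : ∀ {z w : B}, ((p : ℤ) ^ k) • z = ((p : ℤ) ^ k) • w → z = w := fun h =>
    smul_right_injective B hpk h
  -- Leibniz and additivity (exact, by torsion-freeness)
  have hleib : ∀ y ∈ O, ∀ z ∈ O, c (y * z) = c y * z + y * c z := fun y hy z hz => hcancel (by
    rw [← hc _ (hO.mul_mem _ hy _ hz), smul_add, ← smul_mul_assoc, ← mul_smul_comm, ← hc y hy, ← hc z hz]
    noncomm_ring)
  have hadd : ∀ y ∈ O, ∀ z ∈ O, c (y + z) = c y + c z := fun y hy z hz => hcancel (by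
    rw [← hc _ (O.add_mem hy hz), smul_add, ← hc y hy, ← hc z hz]; noncomm_ring)
  have hsmul : ∀ (m : ℤ), ∀ y ∈ O, c (m • y) = m • c y := fun m y hy => hcancel (by
    rw [← hc _ (O.smul_mem m hy), smul_comm, ← hc y hy, smul_sub, mul_smul_comm, smul_mul_assoc])
  -- `c (b^n) = ∑_{i<n} b^i (c b) b^{n-1-i}`; modulo `p` and with commutativity: `n b^{n-1} c b`
  have hpow_res : ∀ (b : B) (hb : b ∈ O) (n : ℕ),
      hO.res p ⟨c (b ^ (n + 1)), hcO _ (hO.pow_mem hb (n + 1))⟩ =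
        ((n + 1 : ℕ) : hO.Residue p) * (hO.res p ⟨b, hb⟩ ^ n * hO.res p ⟨c b, hcO b hb⟩) := by
    intro b hb n
    induction n with
    | zero =>
      simp only [zero_add, pow_one, Nat.cast_one, one_mul, pow_zero]
    | succ n ih =>
      have hbn' : b ^ (n + 1) ∈ O := hO.pow_mem hb (n + 1)
      have hstep : c (b ^ (n + 1 + 1)) = c (b ^ (n + 1)) * b + b ^ (n + 1) * c b := by
        rw [pow_succ (b) (n + 1)]; exact hleib _ hbn' _ hb
      have : (⟨c (b ^ (n + 1 + 1)), hcO _ (hO.pow_mem hb (n + 1 + 1))⟩ : hO.subring) =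
          ⟨c (b ^ (n + 1)), hcO _ hbn'⟩ * ⟨b, hb⟩ + ⟨b ^ (n + 1), hbn'⟩ * ⟨c b, hcO b hb⟩ :=
        Subtype.ext (by simpa only [Subring.coe_add, Subring.coe_mul] using hstep)
      rw [this, map_add, map_mul, map_mul, ih]
      have hbpow : hO.res p ⟨b ^ (n + 1), hbn'⟩ = hO.res p ⟨b, hb⟩ ^ (n + 1) := by
        rw [← map_pow]; congr 1
      rw [hbpow]
      push_cast
      ring
  -- `c (b^p) ∈ p O`
  have hpth : ∀ b ∈ O, c (b ^ p) ∈ (p : ℤ) • O := by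
    intro b hb
    obtain ⟨m, hm⟩ : ∃ m, p = m + 1 := ⟨p - 1, (Nat.sub_add_cancel hp.one_le).symm⟩
    have h := hpow_res b hb m
    have hzero : ((m + 1 : ℕ) : hO.Residue p) = 0 := by rw [← hm]; exact natCast_self_residue hO p
    rw [hzero, zero_mul] at h
    have hbeq : b ^ p = b ^ (m + 1) := by rw [hm]
    rw [hbeq]
    exact res_eq_zero_iff.mp h
  -- every `y` is `b^p + p w`
  intro y hy
  obtain ⟨bA, hbA⟩ := hsurj (hO.res p ⟨y, hy⟩)
  obtain ⟨bs, rfl⟩ := hO.res_surjective p bA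
  rw [frobenius_def, ← map_pow] at hbA
  have hbp : (bs : B) ^ p ∈ O := (bs ^ p).2
  have hdiff : y - (bs : B) ^ p ∈ (p : ℤ) • O := by
    have := (res_eq_res_iff (x := ⟨y, hy⟩) (y := bs ^ p)).mp hbA.symm
    simpa only [Subring.coe_pow] using this
  obtain ⟨w, hw, hyw⟩ := (Submodule.mem_smul_pointwise_iff_exists _ _ O).mp hdiff
  have hy_eq : y = (bs : B) ^ p + (p : ℤ) • w := by rw [hyw, add_sub_cancel]
  have hcy : c y = c ((bs : B) ^ p) + (p : ℤ) • c w := by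
    rw [hy_eq, hadd _ hbp _ (O.smul_mem _ hw), hsmul _ _ hw]
  rw [hc y hy, hcy, pow_succ, mul_smul]
  refine Submodule.smul_mem_pointwise_smul _ _ _ (Submodule.add_mem _ (hpth _ bs.2) ?_)
  exact Submodule.smul_mem_pointwise_smul _ _ O (hcO w hw)

/-- **`[O, O] ⊆ p^k O` for all `k`** when `A = O / p O` is commutative and reduced. [folklore] -/
theorem commutator_mem_smul_pow [IsAddTorsionFree B] (hO : IsZOrder O) (hp : p.Prime)
    (hcomm : ∀ a b : hO.Residue p, a * b = b * a) (hred : ∀ a : hO.Residue p, a * a = 0 → a = 0)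
    (k : ℕ) : ∀ x ∈ O, ∀ y ∈ O, x * y - y * x ∈ ((p : ℤ) ^ k) • O := by
  induction k with
  | zero =>
    intro x hx y hy
    rw [pow_zero, one_smul]
    exact O.sub_mem (hO.mul_mem _ hx _ hy) (hO.mul_mem _ hy _ hx)
  | succ k ih =>
    rcases Nat.eq_zero_or_pos k with rfl | _
    · intro x hx y hy
      rw [zero_add, pow_one]
      have h : hO.res p (⟨x, hx⟩ * ⟨y, hy⟩ - ⟨y, hy⟩ * ⟨x, hx⟩) = 0 := by
        rw [map_sub, map_mul, map_mul, hcomm, sub_self]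
      simpa only [AddSubgroupClass.coe_sub, Subring.coe_mul] using res_eq_zero_iff.mp h
    · exact hO.commutator_mem_smul_succ hp hcomm hred ih

/-- **`⋂_k p^k O = 0`**: an element of `O` divisible by every power of `p` vanishes (its
coordinates in a `ℤ`-basis are divisible by every `p^k`). [folklore] -/
theorem eq_zero_of_forall_mem_smul_pow (hO : IsZOrder O) (hp : p.Prime) {z : B}
    (hz : ∀ k : ℕ, z ∈ ((p : ℤ) ^ k) • O) : z = 0 := by
  obtain ⟨b⟩ := hO.exists_basis_fin_four
  have hz0 : z ∈ O := by simpa using hz 0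
  suffices h : (⟨z, hz0⟩ : O) = 0 by simpa using congrArg Subtype.val h
  refine b.ext_elem fun i => ?_
  rw [map_zero, Finsupp.zero_apply]
  -- the `i`-th coordinate is divisible by every `p^k`
  have hdvd : ∀ k : ℕ, ((p : ℤ) ^ k) ∣ b.repr ⟨z, hz0⟩ i := fun k => by
    obtain ⟨w, hw, hzw⟩ := (Submodule.mem_smul_pointwise_iff_exists _ _ O).mp (hz k)
    have : (⟨z, hz0⟩ : O) = ((p : ℤ) ^ k) • (⟨w, hw⟩ : O) := Subtype.ext hzw.symm
    rw [this, map_smul, Finsupp.smul_apply, smul_eq_mul]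
    exact dvd_mul_right _ _
  set n := b.repr ⟨z, hz0⟩ i
  refine Int.eq_zero_of_abs_lt_dvd (hdvd n.natAbs) ?_
  have h1 : (n.natAbs : ℤ) < (p : ℤ) ^ n.natAbs := by exact_mod_cast Nat.lt_pow_self hp.one_lt
  rw [Int.abs_eq_natAbs]
  exact h1

/-- **If `A = O / p O` is commutative and reduced then `O` is commutative.** [folklore] -/
theorem commute_of_residue_comm_reduced [IsAddTorsionFree B] (hO : IsZOrder O) (hp : p.Prime)
    (hcomm : ∀ a b : hO.Residue p, a * b = b * a) (hred : ∀ a : hO.Residue p, a * a = 0 → a = 0) :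
    ∀ x ∈ O, ∀ y ∈ O, x * y = y * x := fun x hx y hy =>
  sub_eq_zero.mp (hO.eq_zero_of_forall_mem_smul_pow hp fun k =>
    hO.commutator_mem_smul_pow hp hcomm hred k x hx y hy)

/-- **A quaternion algebra has no commutative order**: if `O` is commutative then so is `B = ℚ O`,
whose centre is `ℚ` (`Algebra.IsCentral`) — impossible in dimension `4`. [cite: VignerasLNM800, Ch. I §1 (algèbre centrale simple de dimension 4)] -/
theorem false_of_commute (hO : IsZOrder O) (h : ∀ x ∈ O, ∀ y ∈ O, x * y = y * x) : False := by
  -- `B` is commutative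
  have hB : ∀ X Y : B, X * Y = Y * X := fun X Y => by
    obtain ⟨m, hm, hmX⟩ := hO.isFullLattice.2 X
    obtain ⟨n, hn, hnY⟩ := hO.isFullLattice.2 Y
    have hmnQ : ((m * n : ℤ) : ℚ) ≠ 0 := by exact_mod_cast mul_ne_zero hm hn
    have key : (m * n : ℤ) • (X * Y) = (m * n : ℤ) • (Y * X) := by
      calc (m * n : ℤ) • (X * Y) = (m • X) * (n • Y) := by rw [smul_mul_smul_comm]
        _ = (n • Y) * (m • X) := h _ hmX _ hnY
        _ = (m * n : ℤ) • (Y * X) := by rw [smul_mul_smul_comm, mul_comm n m]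
    have key' : ((m * n : ℤ) : ℚ) • (X * Y) = ((m * n : ℤ) : ℚ) • (Y * X) := by
      rwa [Int.cast_smul_eq_zsmul, Int.cast_smul_eq_zsmul]
    exact smul_right_injective B hmnQ key'
  -- hence its centre is everything, but it is `ℚ` of dimension `1 ≠ 4`
  have hcenter : Subalgebra.center ℚ B = ⊤ :=
    eq_top_iff.mpr fun b _ => Subalgebra.mem_center_iff.mpr fun a => hB a b
  have hbot : (⊥ : Subalgebra ℚ B) = ⊤ := by rw [← hcenter, Algebra.IsCentral.center_eq_bot]
  haveI : Nontrivial B := Module.nontrivial_of_finrank_pos (R := ℚ)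
    (by rw [IsQuaternionAlgebra.finrank_eq_four (K := ℚ) (D := B)]; norm_num)
  have h1 := Subalgebra.bot_eq_top_iff_finrank_eq_one.mp hbot
  rw [IsQuaternionAlgebra.finrank_eq_four (K := ℚ) (D := B)] at h1
  norm_num at h1

/-- **The reduced-commutative central case cannot occur**: a non-trivial idempotent `e` of
`A = O / p O` with `ē = 1 − e`, `eAf = fAe = 0`, `|eAe| = p²` and square-zero-free `eAe` would
make `A` commutative and reduced, hence `O` commutative — absurd. (No maximality needed.) [folklore] -/
theorem false_of_central_reduced (hO : IsZOrder O) (hp : p.Prime) {e : hO.Residue p}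
    (he : IsIdempotentElem e) (hbar : hO.barA p e = 1 - e)
    (hef : Nat.card (peirceCorner e (1 - e)) = 1) (hfe : Nat.card (peirceCorner (1 - e) e) = 1)
    (hee : Nat.card (peirceCorner e e) = p ^ 2)
    (hnosq : ∀ ε ∈ peirceCorner e e, ε * ε = 0 → ε = 0) : False := by
  haveI : IsAddTorsionFree B := isAddTorsionFree_of_charZero_module ℚ B
  obtain ⟨hcomm, hred⟩ := hO.residue_comm_reduced_of_central hp he hbar hef hfe hee hnosq
  exact hO.false_of_commute (hO.commute_of_residue_comm_reduced hp hcomm hred)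

/-! ### Assembly of the idempotent branch -/

/-- **A maximal order with a non-trivial idempotent in `O₁ / p O₁` is residually split at `p`**
(residual form of Vignéras II §2 Thm. 2.3). By the size constraint either the diagonal corners are
small — then some `u ∈ eAf`, `v ∈ fAe` have `u v ≠ 0` (else the degenerate case contradicts
maximality) and we get matrix units — or they are large (central case), which is excluded by the
nilpotent-corner contradiction and the reduced-commutative exclusion. [cite: VignerasLNM800, Ch. II §2 Thm. 2.3] -/
theorem _root_.Literature.NumberTheory.Automorphic.IsMaximalZOrder.isResiduallySplit_of_idempotent
    {O₁ : Submodule ℤ B} (hO : IsZOrder O₁) (hmax : IsMaximalZOrder O₁) (hp : p.Prime)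
    {x : hO.subring} (he : IsIdempotentElem (hO.res p x)) (h0 : hO.res p x ≠ 0) (h1 : hO.res p x ≠ 1) :
    hO.IsResiduallySplit p := by
  haveI : IsAddTorsionFree B := isAddTorsionFree_of_charZero_module ℚ B
  obtain ⟨-, -, hbar⟩ := hO.idempotent_res hp he h0 h1
  set e := hO.res p x with he_def
  rcases hO.card_peirceCorner_cases hp he h0 hbar with ⟨hee, hff, hoff⟩ | ⟨hee, -, hef, hfe⟩
  · -- small diagonal corners
    by_cases hnd : ∃ u ∈ peirceCorner e (1 - e), ∃ v ∈ peirceCorner (1 - e) e, u * v ≠ 0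
    · obtain ⟨u, hu, v, hv, huv⟩ := hnd
      exact hO.isResiduallySplit_of_mul_ne_zero hp he h0 hee hff hoff hu hv huv
    · exfalso
      push Not at hnd
      -- `eAf · fAe = 0`; then `fAe · eAf = 0` too (`(vu)² = v(uv)u = 0` in the line `ℤ f`)
      have hf := he.one_sub
      have hf0 : (1 : hO.Residue p) - e ≠ 0 := fun h => h1 (sub_eq_zero.mp h).symm
      have hfline := hO.peirceCorner_eq_zmultiples hp
        (show (1 : hO.Residue p) - e ∈ peirceCorner (1 - e) (1 - e) by rw [mem_peirceCorner, hf.eq, hf.eq])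
        hf0 hff
      have hnd' : ∀ v ∈ peirceCorner (1 - e) e, ∀ u ∈ peirceCorner e (1 - e), v * u = 0 := by
        intro v hv u hu
        obtain ⟨m, hm⟩ := hfline _ (mul_mem_peirceCorner hv hu hf hf)
        have hsq : v * u * (v * u) = 0 := by
          rw [mul_assoc, ← mul_assoc u, hnd u hu v hv, zero_mul, mul_zero]
        rw [hm] at hsq ⊢
        have : ((m * m : ℤ) : hO.Residue p) * (1 - e) = 0 := by
          rw [Int.cast_mul, mul_assoc, ← hsq, ← mul_assoc ((m : hO.Residue p) * (1 - e)),
            mul_assoc (m : hO.Residue p) (1 - e), ← (Int.cast_commute m (1 - e)).eq, ← mul_assoc, mul_assoc _ (1 - e),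
            hf.eq]
        have hpm : (p : ℤ) ∣ m := by
          have := hO.dvd_of_intCast_mul_eq_zero hp hf0 this
          exact (Nat.prime_iff_prime_int.mp hp).dvd_of_dvd_pow (n := 2) (by rwa [pow_two])
        rw [(hO.intCast_residue_eq_zero_iff hp).mpr hpm, zero_mul]
      -- one of the off-diagonal corners is non-trivial
      have hex : (∃ y ∈ peirceCorner (1 - e) e, y ≠ 0) ∨ ∃ y ∈ peirceCorner e (1 - e), y ≠ 0 := by
        by_contra hall
        push Not at hall
        have h1' : Nat.card (peirceCorner (1 - e) e) = 1 := by
          rw [Nat.card_eq_one_iff_unique]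
          exact ⟨⟨fun a b => Subtype.ext ((hall.1 a a.2).trans (hall.1 b b.2).symm)⟩, ⟨⟨0, AddSubgroup.zero_mem _⟩⟩⟩
        have h2' : Nat.card (peirceCorner e (1 - e)) = 1 := by
          rw [Nat.card_eq_one_iff_unique]
          exact ⟨⟨fun a b => Subtype.ext ((hall.2 a a.2).trans (hall.2 b b.2).symm)⟩, ⟨⟨0, AddSubgroup.zero_mem _⟩⟩⟩
        rw [h1', h2', mul_one] at hoff
        have : 1 < p ^ 2 := Nat.one_lt_pow two_ne_zero hp.one_lt
        omega
      rcases hex with ⟨y, hy, hy0⟩ | ⟨y, hy, hy0⟩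
      · exact IsMaximalZOrder.false_of_degenerate hO hmax hp he hnd hnd' hy hy0
      · exact IsMaximalZOrder.false_of_degenerate' hO hmax hp he hnd hnd' hy hy0
  · -- central case
    exfalso
    by_cases hsq : ∃ ε ∈ peirceCorner e e, ε ≠ 0 ∧ ε * ε = 0
    · obtain ⟨ε, hε, hε0, hεε⟩ := hsq
      exact IsMaximalZOrder.false_of_central_sq_zero hO hmax hp he h1 hbar hef hfe hee hε hε0 hεε
    · push Not at hsq
      exact hO.false_of_central_reduced hp he hbar hef hfe hee fun ε hε hεε =>
        by_contra fun h => hsq ε hε h hεε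

end IsZOrder

end Literature.NumberTheory.Automorphic

end
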